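import Summits.NavierStokesRegularity.FunctionalMining.PalinstrophyLogWindow
import Summits.NavierStokesRegularity.FunctionalMining.NoGo.PalinstrophyLogThreshold
import HarnessLib

/-!
# FunctionalMining — K1-Q3 VERDICT: the log door (a) is a THRESHOLD LAW on `T³`, with `C₀(c) > 0` for EVERY `c > 0` (dict seat, staged v9.2)

Search for candidate a priori estimates; no regularity claim.

STAGED FILE (planner/dict seat cannot file under `FunctionalMining/`; the prove seat files it, proposed
tree name `FunctionalMining/PalinstrophyLogVerdict.lean`). It imports ONLY tree modules:
`PalinstrophyLogWindow.lean` (p203961, prove seat: `oneFortieth_le_logBudgetThreshold`,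
`logBudgetValid_eq_Ici_of_le_one`, `palinstrophyLogBudget_iff_threshold_le` on `0 < c ≤ 1` — NOT
re-proved here; it imports the threshold object `C₀(c) = logBudgetThreshold c` of
`PalinstrophyLogDoorThreshold.lean`, p203192, the large-`C` theorem `palinstrophyLogBudgetLargeC_fin3_holds`,
p203055, and the no-go seat's kernel-checked kill `NoGo/PalinstrophyLogKill.lean`, p203196:
`not_palinstrophyLogBudget_of_le`, every `C ≤ 1/40`, `0 ≤ c ≤ 1`, on the explicit 12-mode field `W12`,
p202836) and the no-go seat's typed threshold statements `NoGo/PalinstrophyLogThreshold.lean` (p202842;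
definitions only are used). Staged 2026-08-20 by planner-pub-nsfunc-dict-g6-0 (cell `pub-nsfunc`,
dictionary seat, gen 6); v9.2 rebased on p203961 and extended by the `c = 100` kernel instance.

WHAT IT ADDS. The dictionary's question K1-Q3 (DICTIONARY §14, door D4) asked whether the logarithmic
palinstrophy budget `d𝒫/dt ≤ C‖ω‖_∞ 𝒫 log(e + c𝒫/ν²)` (`PalinstrophyLogBudget C c`, an a priori
inequality along classical solutions on `T³`; BKM-type control at the `H²` level) holds. The verdict of
record (DICTIONARY §9 N10) is a THRESHOLD LAW, and with the two tree theorems above it is now ONE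
unconditional kernel-checked statement about ONE function `C₀ = logBudgetThreshold (d := Fin 3)`:

* `palinstrophyLogBudget_iff_threshold_fin3`: for every `c > 0` and every `C`,
  `PalinstrophyLogBudget C c ↔ C₀(c) ≤ C` — the valid constants form the closed ray `[C₀(c), ∞)`
  (unconditional now: boundedness below comes from `not_palinstrophyLogBudget_zero_fin3`, the `C = 0`
  instance of the no-go seat's certificate reduction on `W12`, valid for EVERY `c ≥ 0`);
* LOWER BOUNDS, all kernel-checked on the single field `W12`: `logBudgetThreshold_nonneg_fin3` (`0 ≤ C₀(c)`,
  all `c > 0`); the tree's `oneFortieth_le_logBudgetThreshold` (`1/40 ≤ C₀(c)`, `0 < c ≤ 1`, p203961/p203196);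
  NEW `not_palinstrophyLogBudget_one_fiftieth_hundred : ¬ PalinstrophyLogBudget (1/50) 100` — the SAME field
  and amplitude as the `1/40` kill with only the logarithm's bound changed (`log(e + 100·A²𝒫) < 37`; the
  no-go seat's exact certificate `W12c`, `pub-nsfunc-nogo/cert/cert12r_K20_C1o50_c100.json`, margin 11 %,
  confirmed with equal rationals by census-2's independent implementation B, `CERT2-LOGDOOR.md` row 9) —
  hence `not_palinstrophyLogBudget_of_le_hundred` (every `C ≤ 1/50`, `0 ≤ c ≤ 100`),
  `one_fiftieth_le_logBudgetThreshold_fin3` (`1/50 ≤ C₀(c)` on `0 < c ≤ 100`) and, transporting through the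
  log-scale exchange below, `logBudgetThreshold_ge_div_log_fin3` (`(1/50)/(1 + log(c/100)) ≤ C₀(c)` for
  `c ≥ 100`): **`0 < C₀(c)` for EVERY `c > 0`** (`logBudgetThreshold_pos_fin3`) — at every log-scale the door
  fails for all small enough constants (the cell's paper-level lower bound is `2/π` uniformly in `c`,
  `pub-nsfunc-nogo/THRESHOLD.md`, typed as the conjecture `PalinstrophyLogThreshold` in
  `NoGo/PalinstrophyLogThreshold.lean` — `le_logBudgetThreshold_of_failsBelow` records where it lands);
* `logBudgetThreshold_anti_fin3`: `C₀` is non-increasing on `(0, ∞)` (unconditional form of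
  `logBudgetThreshold_anti`);
* NEW STRUCTURAL UPPER SHAPE, no constant from the literature needed: `PalinstrophyLogBudget.of_logScale`
  (`PalinstrophyLogBudget C c'`, `C ≥ 0`, `0 < c ≤ c'` ⟹ `PalinstrophyLogBudget (C·(1 + log(c'/c))) c`,
  because `log(e + c'X) ≤ log(c'/c) + log(e + cX) ≤ (1 + log(c'/c))·log(e + cX)`), hence
  `logBudgetThreshold_le_mul_log_fin3`: `C₀(c) ≤ C₀(c')·(1 + log(c'/c))` for `0 < c ≤ c'`. With
  antitonicity: `C₀(1) ≤ C₀(c) ≤ C₀(1)·(1 + log(1/c))` on `(0, 1]` and `0 ≤ C₀(c) ≤ C₀(1)` on `[1, ∞)` —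
  the threshold curve is squeezed between a constant and an affine function of `log(1/c)` whose two
  coefficients are the single number `C₀(1) ∈ [1/40, ∞)` (this supersedes, for the purpose of the SHAPE
  statement, the staged-only explicit-constant module v7.1/v8.1, whose `A + B·log⁺(1/c)` bound had
  `A, B` in terms of the inexplicit BKM constant);
* `palinstrophyLog_thresholdLaw_fin3`: the facts as one conjunction (the K1-Q3 verdict theorem).

Open (numbers, not shape): the value `C₀(1)`; the cell's window of record is `[2/π, C⋆(1))` with `2/π` a
paper-level lower bound [ours, unreviewed] and `C⋆` the large-`C` theorem's inexplicit constant.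
Nothing here is a regularity statement.
-/

noncomputable section

open Set MeasureTheory
open scoped InnerProductSpace RealInnerProductSpace

namespace Summit.NavierStokesRegularity.FunctionalMining

open Literature.Analysis Literature.Analysis.FunctionSpaces Literature.Analysis.FunctionSpaces.Torus
  Literature.Analysis.FluidPDE

variable {d : Type*} [Fintype d] [DecidableEq d]

/-! ## 1. A structural rescaling of the log-scale: `(C, c') ⟶ (C·(1 + log(c'/c)), c)` -/

/-- `log(e + c'·X) ≤ (1 + log(c'/c))·log(e + c·X)` for `X ≥ 0`, `0 < c ≤ c'`: indeed
`e + c'X ≤ (c'/c)(e + cX)` and `log(e + cX) ≥ 1`. [elementary] -/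
theorem log_exp_one_add_le_mul_log {c c' X : ℝ} (hc : 0 < c) (hcc' : c ≤ c') (hX : 0 ≤ X) :
    Real.log (Real.exp 1 + c' * X) ≤
      (1 + Real.log (c' / c)) * Real.log (Real.exp 1 + c * X) := by
  have he : 0 < Real.exp 1 := Real.exp_pos 1
  have hc' : 0 < c' := hc.trans_le hcc'
  have hr1 : 1 ≤ c' / c := by rw [le_div_iff₀ hc]; linarith
  have hr0 : 0 < c' / c := by positivity
  have hY : 0 < Real.exp 1 + c * X := by positivity
  have hL1 : 1 ≤ Real.log (Real.exp 1 + c * X) := by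
    rw [Real.le_log_iff_exp_le hY]; nlinarith
  have hlr : 0 ≤ Real.log (c' / c) := Real.log_nonneg hr1
  have key : Real.exp 1 + c' * X ≤ c' / c * (Real.exp 1 + c * X) := by
    have e1 : c' / c * (Real.exp 1 + c * X) = c' / c * Real.exp 1 + c' * X := by
      field_simp
    rw [e1]
    nlinarith
  calc Real.log (Real.exp 1 + c' * X)
      ≤ Real.log (c' / c * (Real.exp 1 + c * X)) := Real.log_le_log (by positivity) key
    _ = Real.log (c' / c) + Real.log (Real.exp 1 + c * X) := Real.log_mul hr0.ne' hY.ne'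
    _ ≤ Real.log (c' / c) * Real.log (Real.exp 1 + c * X) + Real.log (Real.exp 1 + c * X) := by
        nlinarith
    _ = (1 + Real.log (c' / c)) * Real.log (Real.exp 1 + c * X) := by ring

/-- **Log-scale exchange for the door (a).** If `PalinstrophyLogBudget C c'` holds with `C ≥ 0`, then for
every `0 < c ≤ c'` the door holds at log-scale `c` with the constant `C·(1 + log(c'/c))`: a smaller `c`
costs at most a factor affine in `log(c'/c)`. (The converse direction, `c ≤ c'` at the same constant, is
`PalinstrophyLogBudget.mono_scale` / `.of_le` in the tree.) Search for candidate a priori estimates; no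
regularity claim. [ours; elementary] -/
theorem PalinstrophyLogBudget.of_logScale {C c c' : ℝ} (h : PalinstrophyLogBudget (d := d) C c')
    (hC : 0 ≤ C) (hc : 0 < c) (hcc' : c ≤ c') :
    PalinstrophyLogBudget (d := d) (C * (1 + Real.log (c' / c))) c := by
  intro hd ν hν a b hab u p hsol t ht M hM hMx R hR
  have h1 := h hd hν hab hsol t ht M hM hMx R hR
  have hP : 0 ≤ torusPalinstrophy (u t) := torusPalinstrophy_nonneg _
  have hX : 0 ≤ torusPalinstrophy (u t) / ν ^ 2 := div_nonneg hP (sq_nonneg ν)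
  have hlog := log_exp_one_add_le_mul_log hc hcc' hX
  have e1 : c' * torusPalinstrophy (u t) / ν ^ 2 = c' * (torusPalinstrophy (u t) / ν ^ 2) := by ring
  have e2 : c * torusPalinstrophy (u t) / ν ^ 2 = c * (torusPalinstrophy (u t) / ν ^ 2) := by ring
  rw [e1] at h1
  rw [e2]
  have hCMP : 0 ≤ C * M * torusPalinstrophy (u t) := mul_nonneg (mul_nonneg hC hM) hP
  calc R ≤ C * M * torusPalinstrophy (u t) * Real.log (Real.exp 1 + c' * (torusPalinstrophy (u t) / ν ^ 2)) := h1
    _ ≤ C * M * torusPalinstrophy (u t) *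
        ((1 + Real.log (c' / c)) * Real.log (Real.exp 1 + c * (torusPalinstrophy (u t) / ν ^ 2))) :=
          mul_le_mul_of_nonneg_left hlog hCMP
    _ = C * (1 + Real.log (c' / c)) * M * torusPalinstrophy (u t) *
        Real.log (Real.exp 1 + c * (torusPalinstrophy (u t) / ν ^ 2)) := by ring

/-- The case `c' = 1`: `PalinstrophyLogBudget C 1`, `C ≥ 0`, `0 < c ≤ 1` ⟹
`PalinstrophyLogBudget (C·(1 + log(1/c))) c`. [ours; elementary] -/
theorem PalinstrophyLogBudget.of_logScale_one {C c : ℝ} (h : PalinstrophyLogBudget (d := d) C 1)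
    (hC : 0 ≤ C) (hc : 0 < c) (hc1 : c ≤ 1) :
    PalinstrophyLogBudget (d := d) (C * (1 + Real.log (1 / c))) c :=
  h.of_logScale hC hc hc1

/-! ## 2. Non-positive constants are refuted for every log-scale (`C = 0` on the field `W12`) -/

/-- **`C = 0` is refuted for every `c ≥ 0` on `T³`**: the no-go seat's certificate reduction
`not_palinstrophyLogBudget_of_bounds` at `C = 0` (the logarithm drops out) on the 12-mode field `W12`
(`N = (8576/675)π² > 0`, `D₃ = (2095005232/50625)π⁴`, amplitude `A = 10⁶π²`: `2D₃/A < 2N`). In words: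
`d𝒫/dt ≤ 0` is not an a priori law. Search for candidate a priori estimates; no regularity claim. [ours] -/
theorem not_palinstrophyLogBudget_zero_fin3 {c : ℝ} (hc : 0 ≤ c) :
    ¬ PalinstrophyLogBudget (d := Fin 3) 0 c := by
  have hπ : 0 < Real.pi ^ 2 := by positivity
  have hA : (0 : ℝ) < 10 ^ 6 * Real.pi ^ 2 := by positivity
  have hω : ∀ x, torusVorticitySqAt LogDoorW12.w x ≤ (2 : ℝ) ^ 2 := fun x =>
    (LogDoorW12.vorticitySq_le x).trans (by norm_num)
  refine not_palinstrophyLogBudget_of_bounds (Fintype.card_fin 3) le_rfl hc LogDoorW12.isSmooth_w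
    LogDoorW12.isDivFree_w (N₀ := 8576 / 675 * Real.pi ^ 2) (P₀ := 464686 / 16875 * Real.pi ^ 2)
    (D₀ := 2095005232 / 50625 * Real.pi ^ 4) (M₀ := 2) (A := 10 ^ 6 * Real.pi ^ 2)
    (by norm_num) hA LogDoorW12.production_w_eq.symm.le LogDoorW12.palinstrophy_w_eq.le
    LogDoorW12.dissipation_w_eq.le hω ?_
  have e1 : (0 : ℝ) * 2 * (464686 / 16875 * Real.pi ^ 2) *
      Real.log (Real.exp 1 + c * ((10 ^ 6 * Real.pi ^ 2) ^ 2 * (464686 / 16875 * Real.pi ^ 2))) = 0 := by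
    ring
  have e2 : 2 * (2095005232 / 50625 * Real.pi ^ 4) / (10 ^ 6 * Real.pi ^ 2) =
      4190010464 / 50625000000 * Real.pi ^ 2 := by
    field_simp
    ring
  rw [e1, e2]
  nlinarith

/-- Hence every `C ≤ 0` is refuted, for every `c ≥ 0` (`PalinstrophyLogBudget.mono`). [ours] -/
theorem not_palinstrophyLogBudget_of_nonpos_fin3 {C c : ℝ} (hC : C ≤ 0) (hc : 0 ≤ c) :
    ¬ PalinstrophyLogBudget (d := Fin 3) C c := fun h =>
  not_palinstrophyLogBudget_zero_fin3 hc (h.mono hc hC)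

/-! ## 2b. The `c = 100` kernel instance on the same field (`C = 1/50`; no-go certificate `W12c`) -/

open LogDoorW12 Real in
/-- **`¬ PalinstrophyLogBudget (1/50) 100` on `T³ = (ℝ/ℤ)³`** — the no-go seat's exact certificate `W12c`
(`cert/cert12r_K20_C1o50_c100.json`; census-2 implementation B: equal rationals, `CERT2-LOGDOOR.md` row 9),
kernel-checked here by the proof of `not_palinstrophyLogBudget_one_fortieth` (`NoGo/PalinstrophyLogKill.lean`)
with ONLY the logarithm's bound changed: witness `W12` at amplitude `A = 50000π²`,
`M₀ = √(57029/50625) < 1.0614`, `log(e + 100·A²𝒫) < 37` (`π < 3.1416`, `e < 2.7182818286`,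
`2.7182818283³⁷ ≤ e³⁷`), and `(1/50)·1.0614·(464686/16875)·37 = 21.62… < 23.75… = 2·(8576/675) −
2·(2095005232/50625)/50000` (coefficients of `π²`). Search for candidate a priori estimates; no regularity
claim. [ours] -/
theorem not_palinstrophyLogBudget_one_fiftieth_hundred :
    ¬ PalinstrophyLogBudget (d := Fin 3) (1 / 50) 100 := by
  have hπ : π < 3.1416 := by linarith [Real.pi_lt_d6]
  have hπ0 : 0 < π := Real.pi_pos
  have hπ2 : 0 < π ^ 2 := by positivity
  have hs : Real.sqrt (57029 / 50625) < 1.0614 := by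
    rw [Real.sqrt_lt' (by norm_num)]
    norm_num
  have hs0 : 0 ≤ Real.sqrt (57029 / 50625) := Real.sqrt_nonneg _
  refine not_palinstrophyLogBudget_of_bounds (by simp) (by norm_num) (by norm_num) isSmooth_w
    isDivFree_w hs0 (A := 50000 * π ^ 2) (by positivity) production_w_eq.ge palinstrophy_w_eq.le
    dissipation_w_eq.le (fun x => ?_) ?_
  · rw [Real.sq_sqrt (by norm_num)]
    exact vorticitySq_le x
  have he1 : 1 ≤ Real.exp 1 := by linarith [Real.add_one_le_exp (1 : ℝ)]
  have hX1 : 1 ≤ Real.exp 1 + 100 * ((50000 * π ^ 2) ^ 2 * (464686 / 16875 * π ^ 2)) := by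
    have : 0 ≤ 100 * ((50000 * π ^ 2) ^ 2 * (464686 / 16875 * π ^ 2)) := by positivity
    linarith
  have hX0 : 0 < Real.exp 1 + 100 * ((50000 * π ^ 2) ^ 2 * (464686 / 16875 * π ^ 2)) := by linarith
  have hlog : Real.log (Real.exp 1 + 100 * ((50000 * π ^ 2) ^ 2 * (464686 / 16875 * π ^ 2))) < 37 := by
    rw [Real.log_lt_iff_lt_exp hX0]
    have h6 : π ^ 6 < 3.1416 ^ 6 := pow_lt_pow_left₀ hπ hπ0.le (by norm_num)
    have hexp : (2.7182818283 : ℝ) ^ 37 ≤ Real.exp 37 := by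
      have := Real.exp_one_gt_d9
      have h37 : Real.exp 37 = Real.exp 1 ^ 37 := by
        rw [Real.exp_one_pow]
        norm_num
      rw [h37]
      exact pow_le_pow_left₀ (by norm_num) this.le 37
    have e : 100 * ((50000 * π ^ 2) ^ 2 * (464686 / 16875 * π ^ 2)) =
        250000000000 * (464686 / 16875) * π ^ 6 := by ring
    rw [e]
    calc Real.exp 1 + 250000000000 * (464686 / 16875) * π ^ 6
        < 2.7182818286 + 250000000000 * (464686 / 16875) * 3.1416 ^ 6 := by
          have := Real.exp_one_lt_d9
          have : 250000000000 * (464686 / 16875) * π ^ 6 <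
              250000000000 * (464686 / 16875) * 3.1416 ^ 6 :=
            mul_lt_mul_of_pos_left h6 (by norm_num)
          linarith
      _ < (2.7182818283 : ℝ) ^ 37 := by norm_num
      _ ≤ Real.exp 37 := hexp
  have hlog0 :
      0 ≤ Real.log (Real.exp 1 + 100 * ((50000 * π ^ 2) ^ 2 * (464686 / 16875 * π ^ 2))) :=
    Real.log_nonneg hX1
  have e2 : 2 * (8576 / 675 * π ^ 2) - 2 * (2095005232 / 50625 * π ^ 4) / (50000 * π ^ 2) =
      3758124346 / 158203125 * π ^ 2 := by
    field_simp
    ring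
  rw [e2]
  have h1 : 1 / 50 * Real.sqrt (57029 / 50625) * (464686 / 16875 * π ^ 2) ≤
      1 / 50 * 1.0614 * (464686 / 16875 * π ^ 2) := by
    have : 0 ≤ 1 / 50 * (464686 / 16875 * π ^ 2) := by positivity
    nlinarith [hs]
  calc 1 / 50 * Real.sqrt (57029 / 50625) * (464686 / 16875 * π ^ 2) *
        Real.log (Real.exp 1 + 100 * ((50000 * π ^ 2) ^ 2 * (464686 / 16875 * π ^ 2)))
      ≤ 1 / 50 * 1.0614 * (464686 / 16875 * π ^ 2) * 37 :=
        mul_le_mul h1 hlog.le hlog0 (by positivity)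
    _ < 3758124346 / 158203125 * π ^ 2 := by nlinarith [hπ2]

/-- **Kernel-checked range: `¬ PalinstrophyLogBudget C c` for every `C ≤ 1/50` and every `0 ≤ c ≤ 100`**
(monotonicity `PalinstrophyLogBudget.of_le` in `C` and `c`). Search for candidate a priori estimates; no
regularity claim. [ours] -/
theorem not_palinstrophyLogBudget_of_le_hundred {C c : ℝ} (hC : C ≤ 1 / 50) (hc0 : 0 ≤ c)
    (hc : c ≤ 100) : ¬ PalinstrophyLogBudget (d := Fin 3) C c := fun h =>
  not_palinstrophyLogBudget_one_fiftieth_hundred (h.of_le hC (by norm_num) hc0 hc)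

/-! ## 3. The threshold `C₀(c) = logBudgetThreshold c` on `T³`: unconditional bookkeeping -/

/-- `0 ≤ C₀(c)` for every `c > 0`. [ours] -/
theorem logBudgetThreshold_nonneg_fin3 {c : ℝ} (hc : 0 < c) :
    0 ≤ logBudgetThreshold (d := Fin 3) c :=
  le_logBudgetThreshold_fin3 hc (not_palinstrophyLogBudget_zero_fin3 hc.le)

/-- **`1/50 ≤ C₀(c)` for `0 < c ≤ 100`** — the `c = 100` kernel instance placed under the threshold (on
`0 < c ≤ 1` the tree's `oneFortieth_le_logBudgetThreshold`, p203961, is better). [ours] -/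
theorem one_fiftieth_le_logBudgetThreshold_fin3 {c : ℝ} (hc0 : 0 < c) (hc1 : c ≤ 100) :
    1 / 50 ≤ logBudgetThreshold (d := Fin 3) c :=
  le_logBudgetThreshold_fin3 hc0 (not_palinstrophyLogBudget_of_le_hundred le_rfl hc0.le hc1)

/-- The valid set is EXACTLY the closed ray `[C₀(c), ∞)`, for every `c > 0` — unconditional form of
`logBudgetValid_eq_Ici_fin3`. [ours] -/
theorem logBudgetValid_eq_Ici_fin3' {c : ℝ} (hc : 0 < c) :
    logBudgetValid (d := Fin 3) c = Set.Ici (logBudgetThreshold (d := Fin 3) c) :=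
  logBudgetValid_eq_Ici_fin3 hc (not_palinstrophyLogBudget_zero_fin3 hc.le)

/-- **The door (a) holds at `(C, c)` iff `C₀(c) ≤ C`** (`c > 0`). [ours] -/
theorem palinstrophyLogBudget_iff_threshold_fin3 {C c : ℝ} (hc : 0 < c) :
    PalinstrophyLogBudget (d := Fin 3) C c ↔ logBudgetThreshold (d := Fin 3) c ≤ C := by
  have h := logBudgetValid_eq_Ici_fin3' hc
  constructor
  · intro hC
    have hmem : C ∈ logBudgetValid (d := Fin 3) c := hC
    rw [h] at hmem
    exact hmem
  · intro hC
    have hmem : C ∈ logBudgetValid (d := Fin 3) c := by rw [h]; exact hC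
    exact hmem

/-- `C₀` is non-increasing on `(0, ∞)` — unconditional form of `logBudgetThreshold_anti`. [ours] -/
theorem logBudgetThreshold_anti_fin3 {c c' : ℝ} (hc : 0 < c) (hcc' : c ≤ c') :
    logBudgetThreshold (d := Fin 3) c' ≤ logBudgetThreshold (d := Fin 3) c :=
  logBudgetThreshold_anti hc.le hcc' le_rfl (not_palinstrophyLogBudget_zero_fin3 hc.le)
    (logBudgetValid_nonempty_fin3 hc) (not_palinstrophyLogBudget_zero_fin3 (hc.le.trans hcc'))

/-- `C₀` is antitone on `(0, ∞)` (Mathlib phrasing). [ours] -/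
theorem logBudgetThreshold_antitoneOn_fin3 :
    AntitoneOn (logBudgetThreshold (d := Fin 3)) (Set.Ioi 0) :=
  fun _ hc _ _ hcc' => logBudgetThreshold_anti_fin3 hc hcc'

/-- **Structural upper shape**: `C₀(c) ≤ C₀(c')·(1 + log(c'/c))` for `0 < c ≤ c'`. [ours] -/
theorem logBudgetThreshold_le_mul_log_fin3 {c c' : ℝ} (hc : 0 < c) (hcc' : c ≤ c') :
    logBudgetThreshold (d := Fin 3) c ≤
      logBudgetThreshold (d := Fin 3) c' * (1 + Real.log (c' / c)) := by
  have hc' : 0 < c' := hc.trans_le hcc'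
  have hmem := logBudgetThreshold_mem_fin3 hc'
  have h0 := logBudgetThreshold_nonneg_fin3 hc'
  exact logBudgetThreshold_le_fin3 hc (not_palinstrophyLogBudget_zero_fin3 hc.le)
    (hmem.of_logScale h0 hc hcc')

/-- On `(0, 1]`: `C₀(1) ≤ C₀(c) ≤ C₀(1)·(1 + log(1/c))` — the threshold curve is squeezed between a
constant and an affine function of `log(1/c)` with both coefficients equal to `C₀(1)`. [ours] -/
theorem logBudgetThreshold_shape_fin3 {c : ℝ} (hc0 : 0 < c) (hc1 : c ≤ 1) :
    logBudgetThreshold (d := Fin 3) 1 ≤ logBudgetThreshold (d := Fin 3) c ∧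
      logBudgetThreshold (d := Fin 3) c ≤
        logBudgetThreshold (d := Fin 3) 1 * (1 + Real.log (1 / c)) :=
  ⟨logBudgetThreshold_anti_fin3 hc0 hc1, logBudgetThreshold_le_mul_log_fin3 hc0 hc1⟩

/-- **Transported lower bound for large log-scales: `(1/50)/(1 + log(c/100)) ≤ C₀(c)` for `c ≥ 100`** (the
`c = 100` kernel instance carried to every larger `c` by the log-scale exchange
`logBudgetThreshold_le_mul_log_fin3`). [ours] -/
theorem logBudgetThreshold_ge_div_log_fin3 {c : ℝ} (hc : 100 ≤ c) :
    1 / 50 / (1 + Real.log (c / 100)) ≤ logBudgetThreshold (d := Fin 3) c := by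
  have h100 : (0 : ℝ) < 100 := by norm_num
  have hL : 0 ≤ Real.log (c / 100) := Real.log_nonneg (by rw [le_div_iff₀ h100]; linarith)
  have hL1 : 0 < 1 + Real.log (c / 100) := by linarith
  rw [div_le_iff₀ hL1]
  exact (one_fiftieth_le_logBudgetThreshold_fin3 h100 le_rfl).trans
    (logBudgetThreshold_le_mul_log_fin3 h100 hc)

/-- **`0 < C₀(c)` for EVERY `c > 0`**: at every log-scale the door (a) fails for all small enough constants
(kernel-checked: `1/40` on `(0, 1]`, `1/50` on `(0, 100]`, `(1/50)/(1 + log(c/100))` on `[100, ∞)`, all from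
the single field `W12`). Search for candidate a priori estimates; no regularity claim. [ours] -/
theorem logBudgetThreshold_pos_fin3 {c : ℝ} (hc : 0 < c) : 0 < logBudgetThreshold (d := Fin 3) c := by
  rcases le_or_gt c 100 with h | h
  · exact lt_of_lt_of_le (by norm_num) (one_fiftieth_le_logBudgetThreshold_fin3 hc h)
  · have hL : 0 ≤ Real.log (c / 100) :=
      Real.log_nonneg (by rw [le_div_iff₀ (by norm_num : (0:ℝ) < 100)]; linarith)
    have hpos : 0 < 1 / 50 / (1 + Real.log (c / 100)) := by positivity
    exact hpos.trans_le (logBudgetThreshold_ge_div_log_fin3 h.le)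

/-- Every `c > 0` has SOME refuted positive constant (existential packaging of `logBudgetThreshold_pos_fin3`
through `palinstrophyLogBudget_iff_threshold_fin3`). [ours] -/
theorem exists_pos_not_palinstrophyLogBudget_fin3 {c : ℝ} (hc : 0 < c) :
    ∃ C : ℝ, 0 < C ∧ ¬ PalinstrophyLogBudget (d := Fin 3) C c := by
  obtain ⟨C, hC0, hC1⟩ := exists_between (logBudgetThreshold_pos_fin3 hc)
  exact ⟨C, hC0, fun h => absurd ((palinstrophyLogBudget_iff_threshold_fin3 hc).mp h) (not_le.mpr hC1)⟩

/-- Where the no-go seat's threshold statements land: `PalinstrophyLogBudgetFailsBelow κ` (every `C < κ`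
refuted at every `c > 0`; `κ = 2/π` is the conjecture `PalinstrophyLogThreshold` of
`NoGo/PalinstrophyLogThreshold.lean`, paper-level) gives `κ ≤ C₀(c)` for every `c > 0`. [ours] -/
theorem le_logBudgetThreshold_of_failsBelow {κ c : ℝ} (h : PalinstrophyLogBudgetFailsBelow (d := Fin 3) κ)
    (hc : 0 < c) : κ ≤ logBudgetThreshold (d := Fin 3) c := by
  rcases le_or_gt κ (logBudgetThreshold (d := Fin 3) c) with hle | hlt
  · exact hle
  · obtain ⟨C, h1, h2⟩ := exists_between hlt
    exact absurd (le_logBudgetThreshold_fin3 hc (h c hc C h2)) (not_le.mpr h1)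

/-- The unconditional kernel-checked instance of the no-go seat's all-`c` statement:
`PalinstrophyLogBudgetFailsBelow 0` (every `C < 0` refuted at every `c > 0`). (The `1/40` kill is stated for
`0 < c ≤ 1` only, so it is not of this all-`c` shape; the paper-level `2/π` is.) [ours] -/
theorem palinstrophyLogBudgetFailsBelow_zero_fin3 : PalinstrophyLogBudgetFailsBelow (d := Fin 3) 0 :=
  fun _ hc _ hC => not_palinstrophyLogBudget_of_nonpos_fin3 hC.le hc.le

/-! ## 4. The verdict theorem -/

/-- **K1-Q3 VERDICT (cell `pub-nsfunc`): the logarithmic palinstrophy budget is a THRESHOLD LAW on `T³`.**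
With `C₀ := logBudgetThreshold (d := Fin 3)`:
(i) for every `c > 0` and every `C`, `PalinstrophyLogBudget C c ↔ C₀ c ≤ C` (valid constants = the
closed ray `[C₀(c), ∞)`; in particular the door holds for SOME constant at every `c > 0` — the large-`C`
theorem — and fails for every `C < C₀(c)`);
(ii) `C₀` is non-increasing on `(0, ∞)`;
(iii) `0 < C₀(c)` for EVERY `c > 0`; quantitatively `1/40 ≤ C₀(c)` for `0 < c ≤ 1`, `1/50 ≤ C₀(c)` for
`0 < c ≤ 100`, `(1/50)/(1 + log(c/100)) ≤ C₀(c)` for `c ≥ 100` (kernel-checked kills on the one field `W12`);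
(iv) `C₀(c) ≤ C₀(c')·(1 + log(c'/c))` for `0 < c ≤ c'` (so `C₀(c) = O(log(1/c))` as `c → 0`, `O(1)` for
`c ≥ 1`).
Paper-level complements [ours, unreviewed, NOT used here]: `C₀(c) ≥ 2/π` for every `c`
(`PalinstrophyLogThreshold`) and `C₀(c) ≥ (2/π − o(1))·log(1/c)` as `c → 0`. A priori inequalities only;
search for candidate a priori estimates; no regularity claim. [ours] -/
theorem palinstrophyLog_thresholdLaw_fin3 :
    (∀ c : ℝ, 0 < c → ∀ C : ℝ,
        (PalinstrophyLogBudget (d := Fin 3) C c ↔ logBudgetThreshold (d := Fin 3) c ≤ C)) ∧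
    AntitoneOn (logBudgetThreshold (d := Fin 3)) (Set.Ioi 0) ∧
    (∀ c : ℝ, 0 < c → 0 < logBudgetThreshold (d := Fin 3) c) ∧
    (∀ c : ℝ, 0 < c → c ≤ 1 → 1 / 40 ≤ logBudgetThreshold (d := Fin 3) c) ∧
    (∀ c : ℝ, 0 < c → c ≤ 100 → 1 / 50 ≤ logBudgetThreshold (d := Fin 3) c) ∧
    (∀ c : ℝ, 100 ≤ c → 1 / 50 / (1 + Real.log (c / 100)) ≤ logBudgetThreshold (d := Fin 3) c) ∧
    (∀ c c' : ℝ, 0 < c → c ≤ c' →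
        logBudgetThreshold (d := Fin 3) c ≤ logBudgetThreshold (d := Fin 3) c' * (1 + Real.log (c' / c))) :=
  ⟨fun _ hc _ => palinstrophyLogBudget_iff_threshold_fin3 hc, logBudgetThreshold_antitoneOn_fin3,
    fun _ hc => logBudgetThreshold_pos_fin3 hc, fun _ hc0 hc1 => oneFortieth_le_logBudgetThreshold hc0 hc1,
    fun _ hc0 hc1 => one_fiftieth_le_logBudgetThreshold_fin3 hc0 hc1,
    fun _ hc => logBudgetThreshold_ge_div_log_fin3 hc,
    fun _ _ hc hcc' => logBudgetThreshold_le_mul_log_fin3 hc hcc'⟩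

/-- The same verdict packaged as an existence statement over an abstract threshold function (the form
quoted in DICTIONARY §14). [ours] -/
theorem palinstrophyLog_thresholdLaw_fin3' :
    ∃ C₀ : ℝ → ℝ, AntitoneOn C₀ (Set.Ioi 0) ∧ (∀ c, 0 < c → 0 < C₀ c) ∧
      (∀ c, 0 < c → c ≤ 1 → 1 / 40 ≤ C₀ c) ∧
      (∀ c, 0 < c → c ≤ 100 → 1 / 50 ≤ C₀ c) ∧
      (∀ c, 100 ≤ c → 1 / 50 / (1 + Real.log (c / 100)) ≤ C₀ c) ∧
      (∀ c c', 0 < c → c ≤ c' → C₀ c ≤ C₀ c' * (1 + Real.log (c' / c))) ∧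
      ∀ c, 0 < c → ∀ C, (PalinstrophyLogBudget (d := Fin 3) C c ↔ C₀ c ≤ C) := by
  obtain ⟨h1, h2, h3, h4, h5, h6, h7⟩ := palinstrophyLog_thresholdLaw_fin3
  exact ⟨_, h2, h3, h4, h5, h6, h7, h1⟩

end Summit.NavierStokesRegularity.FunctionalMining

end
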